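import Summits.Ventures.PercRepro.Night2LocalD2KZero
import Summits.Ventures.PercRepro.Night2LocalD2R14Basis

/-!
# PercRepro — the coloop cell split on the position of `E ∖ G`; the (6,4) row modulo its Case A (night-2, gen 15)

With `kColoops M G = 1` the coloop `y` of `M|G` is unique; either `ρ(E ∖ y) ≤ 5` (CASE B, a theorem:
`localShadowHall_of_rkN_erase_le`, Night2LocalD2KOneB) or `ρ(E ∖ y) = 6` (CASE A, the solid problem, NIGHT-2-k1.md).

* **`localShadowHall_d2_of_kColoops_eq_one`** — the cell `kColoops = 1` modulo Case A.
* **`shadowHall_six_four_of_local_caseA`** — THE (6,4) SHADOW ROW FOR EVERY FINITE MATROID, MODULO CASE A of the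
  coloop cell of loopless simple rank-6 matroids: `G ∈ flatsQ N 5`, `|E ∖ G| = 2`, `kColoops N G = 1`, `y` the coloop,
  `ρ(E ∖ y) = 6` ⟹ `LocalShadowHall N 4 G`.
-/

namespace PercRepro.Shadow

open Finset PerFlat ThmH

variable {α : Type*} [DecidableEq α] {M : Matroid α} [M.Finite]

open scoped Classical in
/-- `kColoops M G = 1` names the coloop: some `y ∈ G` with `y ∉ cl(G ∖ y)`. -/
theorem exists_coloop_of_kColoops_eq_one {G : Finset α} (hk : kColoops M G = 1) :
    ∃ y ∈ G, y ∉ clF M (G.erase y) := by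
  unfold kColoops at hk
  obtain ⟨y, hy⟩ := Finset.card_eq_one.1 hk
  have hmem : y ∈ G.filter (fun y => y ∉ clF M (G.erase y)) := by
    rw [hy]; exact Finset.mem_singleton_self y
  rw [Finset.mem_filter] at hmem
  exact ⟨y, hmem.1, hmem.2⟩

open scoped Classical in
/-- **The cell `kColoops = 1` modulo Case A** (`ρ(E ∖ y) = 6` for the coloop `y`). -/
theorem localShadowHall_d2_of_kColoops_eq_one {G : Finset α} (hG : G ∈ flatsQ M (4 + 1))
    (hk : kColoops M G = 1)
    (hA : ∀ y ∈ G, y ∉ clF M (G.erase y) → 6 ≤ rkN M ((gr M).erase y) → LocalShadowHall M 4 G) :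
    LocalShadowHall M 4 G := by
  obtain ⟨y, hyG, hyc⟩ := exists_coloop_of_kColoops_eq_one hk
  by_cases hr : 6 ≤ rkN M ((gr M).erase y)
  · exact hA y hyG hyc hr
  · push Not at hr
    exact localShadowHall_of_rkN_erase_le hG (by rw [rkN_erase_eq_of_coloop hG hyG hyc]) (by omega)

section SixFour

variable {α' : Type} [DecidableEq α']

/-- **THE `(6, 4)` SHADOW ROW FOR EVERY FINITE MATROID, MODULO CASE A OF THE COLOOP CELL** of loopless simple
rank-`6` matroids (`|E ∖ G| = 2`, `kColoops = 1`, `ρ(E ∖ y) = 6` for the coloop `y`). -/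
theorem shadowHall_six_four_of_local_caseA
    (hlocA : ∀ (N : Matroid α') [N.Finite], (∀ e ∈ gr N, ∀ f ∈ gr N, e ≠ f → rkN N {e, f} = 2) →
      (∀ e ∈ gr N, N.Indep {e}) → N.eRank = ((6 : ℕ) : ℕ∞) →
      ∀ G ∈ flatsQ N (4 + 1), (gr N \ G).card = 2 → kColoops N G = 1 →
      ∀ y ∈ G, y ∉ clF N (G.erase y) → 6 ≤ rkN N ((gr N).erase y) → LocalShadowHall N 4 G)
    (M : Matroid α') [M.Finite] : ShadowHall M 6 4 (phiK 6 4) := by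
  apply shadowHall_six_four_of_local_two_one
  intro N _ hs hl hr G hG hd hk
  exact localShadowHall_d2_of_kColoops_eq_one hG hk (fun y hy hyc hr6 => hlocA N hs hl hr G hG hd hk y hy hyc hr6)

end SixFour

end PercRepro.Shadow
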